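import Mathlib
import Literature.Analysis.FluidPDE.SelfSimilarEulerProfile
import Literature.Analysis.FluidPDE.SelfSimilarEulerProfileVorticity
import Literature.Analysis.FluidPDE.SelfSimilarEulerOutgoingExclusionTools
import HarnessLib

/-!
# Crux E `PowerGaugeEulerLiouville` (stmt-NavierStokesRegularity-19832): BALLISTIC IDENTITIES ALONG SIMILARITY ORBITS
# (crux idea «ballistic-faces», ns-idea-11 g7: B1 vector balance, B2 radial balance, B3 orbit laws, B3′ orbit virial, B4 perihelion law)
# (width seat ns-ezl-w3 g5, T1 base)

Route №10 `EulerZoomLiouville` (NavierStokesRegularity), crux E.  For a `C²` self-similar Euler profile `(U, P)` (CIV (3.3), centre `0`,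
rate `γ`) with similarity field `W = γy + U` (`selfSimilarTransport γ 0 U`) and Bernoulli function `ℋ = ½|W|² + P − ½γ(1−γ)|y|²`
(`selfSimilarBernoulli γ 0 U P`), the profile equation is Newton's law for a damped particle in a repulsive well along the orbits `Y′ = W(Y)`:

* `fderiv_transport_apply_transport` (B1) — `DW(y)[W(y)] = γ W(y) − (1−γ) U(y) − ∇P(y)` (i.e. `Ÿ = −(1−2γ)Ẏ + γ(1−γ)Y − ∇P(Y)`);
* `radialBalance` (B2 = `Sig.radialBalance` of the card's sketch) — `⟪y, DW(y)W(y)⟫ = (2γ−1)⟪y, W(y)⟫ + γ(1−γ)|y|² − ⟪y, ∇P(y)⟫`;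
* `hasDerivAt_half_norm_sq_orbit`, `hasDerivAt_inner_transport_orbit` (B3) — along a forward orbit `Y′ = W(Y)`:
  `d/dσ ½|Y|² = ⟪Y, W(Y)⟫` and `d/dσ ⟪Y, W(Y)⟫ = |W(Y)|² + (2γ−1)⟪Y, W(Y)⟫ + γ(1−γ)|Y|² − ⟪Y, ∇P(Y)⟫`;
* `hasDerivAt_orbitVirial` (B3′) — `d/dσ [e^{(1−2γ)σ}(ℋ(Y) + ½(1−2γ)⟪Y, W(Y)⟫)] = (1−2γ) e^{(1−2γ)σ} (P(Y) − ½⟪Y, ∇P(Y)⟫)`;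
* `perihelionLaw` (B4) — a radial turning point `⟪Y(σ₀), W(Y(σ₀))⟫ = 0` with SUB-VIRIAL radial pressure force
  `⟪Y, ∇P(Y)⟫ < |W(Y)|² + γ(1−γ)|Y|²` at `σ₀` is a local MINIMUM of `σ ↦ |Y(σ)|²` (fly-by; aphelia need the gradient ridge).

These are the textbook laws the card uses to pin the needle's parcels (oblique hops, parked cells); class-free, pure calculus on CIV (3.3).
WHAT THIS IS NOT: not NS regularity, not the crux E, no stub of any skeleton — portrait identities for the T1/T2 faces of THE ONE STATEMENT
(`Sig.stub_selfSimilarC2Needle`); `--supports` stmt-19832; 19832 OPEN; MODEL lattice (E/NS strata), not E.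
[cite: ConstantinIgnatovaVicol2026Putative, §3.1.1 eq. (3.3), §3.4 eq. (3.19), §3.4.3 eqs. (3.30)–(3.31)]
-/

noncomputable section

-- flat `Theorems/<Route><Decl>…` files of one crux share the namespace of the crux (tree convention: `Summit.<S>.<S>.…`)
set_option linter.dupNamespace false

open Set Filter Topology InnerProductSpace Metric
open scoped RealInnerProductSpace

namespace Summit.NavierStokesRegularity.NavierStokesRegularity.Theorems.PowerGaugeEulerLiouville

namespace Ballistic

open Literature.Analysis Literature.Analysis.FluidPDE

variable {γ : ℝ} {U : EuclideanSpace ℝ (Fin 3) → EuclideanSpace ℝ (Fin 3)} {P : EuclideanSpace ℝ (Fin 3) → ℝ}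

/-- **(B1) THE PROFILE EQUATION AS NEWTON'S LAW ALONG SIMILARITY ORBITS**: `DW(y)[W(y)] = γ W(y) − (1−γ) U(y) − ∇P(y)` for
`W = γy + U` — the acceleration of a parcel is friction `−(1−2γ)Ẏ` plus the repulsive force `γ(1−γ)Y` minus `∇P`
(`γW − (1−γ)U = −(1−2γ)W + γ(1−γ)y`). [cite: ConstantinIgnatovaVicol2026Putative, §3.1.1 eq. (3.3)] -/
theorem fderiv_transport_apply_transport (h : IsSelfSimilarEulerProfile γ 0 U P) (y : EuclideanSpace ℝ (Fin 3)) :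
    fderiv ℝ (selfSimilarTransport γ 0 U) y (selfSimilarTransport γ 0 U y) =
      γ • selfSimilarTransport γ 0 U y - (1 - γ) • U y - gradient P y := by
  rw [(hasFDerivAt_selfSimilarTransport (γ := γ) (c := 0) h.differentiable_velocity y).fderiv]
  have e := h.profile_eq_transport y
  have hDU : fderiv ℝ U y (selfSimilarTransport γ 0 U y) = -((1 - γ) • U y) - gradient P y := by
    rw [sub_eq_add_neg, ← neg_add, eq_neg_iff_add_eq_zero]
    convert e using 1
    abel
  change γ • selfSimilarTransport γ 0 U y + fderiv ℝ U y (selfSimilarTransport γ 0 U y) = _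
  rw [hDU]
  abel

/-- **(B2) RADIAL BALANCE** (`Sig.radialBalance` of the «ballistic-faces» sketch, centre `0`):
`⟪y, DW(y) W(y)⟫ = (2γ−1)⟪y, W(y)⟫ + γ(1−γ)|y|² − ⟪y, ∇P(y)⟫`. [cite: ConstantinIgnatovaVicol2026Putative, §3.1.1 eq. (3.3)] -/
theorem radialBalance (h : IsSelfSimilarEulerProfile γ 0 U P) (y : EuclideanSpace ℝ (Fin 3)) :
    ⟪y, fderiv ℝ (selfSimilarTransport γ 0 U) y (selfSimilarTransport γ 0 U y)⟫ =
      (2 * γ - 1) * ⟪y, selfSimilarTransport γ 0 U y⟫ + γ * (1 - γ) * ‖y‖ ^ 2 - ⟪y, gradient P y⟫ := by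
  rw [fderiv_transport_apply_transport h y]
  have hU : U y = selfSimilarTransport γ 0 U y - γ • y := by
    rw [selfSimilarTransport_apply, sub_zero]; abel
  rw [hU]
  simp only [smul_sub, inner_sub_right, inner_smul_right, real_inner_self_eq_norm_sq]
  ring

/-- **(B3, radius) RADIAL SPEED ALONG A FORWARD ORBIT**: if `Y′(σ) = W(Y(σ))` then `d/dσ ½|Y|² = ⟪Y, W(Y)⟫`. [folklore] -/
theorem hasDerivAt_half_norm_sq_orbit {Y : ℝ → EuclideanSpace ℝ (Fin 3)} {σ : ℝ}
    (hY : HasDerivAt Y (selfSimilarTransport γ 0 U (Y σ)) σ) :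
    HasDerivAt (fun s => (1 / 2 : ℝ) * ‖Y s‖ ^ 2) ⟪Y σ, selfSimilarTransport γ 0 U (Y σ)⟫ σ := by
  have h := (hY.inner ℝ hY).const_mul (1 / 2 : ℝ)
  have e : (fun s => (1 / 2 : ℝ) * ⟪Y s, Y s⟫) = fun s => (1 / 2 : ℝ) * ‖Y s‖ ^ 2 := by
    funext s; rw [real_inner_self_eq_norm_sq]
  rw [e] at h
  refine h.congr_deriv ?_
  rw [real_inner_comm]; ring

/-- **(B3) RADIAL BALANCE ALONG A FORWARD ORBIT**: if `Y′(σ) = W(Y(σ))` then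
`d/dσ ⟪Y, W(Y)⟫ = |W(Y)|² + (2γ−1)⟪Y, W(Y)⟫ + γ(1−γ)|Y|² − ⟪Y, ∇P(Y)⟫` at `σ`. [cite: ConstantinIgnatovaVicol2026Putative, §3.1.1 eq. (3.3)] -/
theorem hasDerivAt_inner_transport_orbit (h : IsSelfSimilarEulerProfile γ 0 U P) {Y : ℝ → EuclideanSpace ℝ (Fin 3)} {σ : ℝ}
    (hY : HasDerivAt Y (selfSimilarTransport γ 0 U (Y σ)) σ) :
    HasDerivAt (fun s => ⟪Y s, selfSimilarTransport γ 0 U (Y s)⟫)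
      (‖selfSimilarTransport γ 0 U (Y σ)‖ ^ 2 + (2 * γ - 1) * ⟪Y σ, selfSimilarTransport γ 0 U (Y σ)⟫ +
        γ * (1 - γ) * ‖Y σ‖ ^ 2 - ⟪Y σ, gradient P (Y σ)⟫) σ := by
  have hW : HasFDerivAt (selfSimilarTransport γ 0 U) (fderiv ℝ (selfSimilarTransport γ 0 U) (Y σ)) (Y σ) :=
    (hasFDerivAt_selfSimilarTransport (γ := γ) (c := 0) h.differentiable_velocity (Y σ)).differentiableAt.hasFDerivAt
  have h1 := hY.inner ℝ (hW.comp_hasDerivAt σ hY)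
  refine h1.congr_deriv ?_
  simp only [Function.comp_apply]
  rw [radialBalance h (Y σ), real_inner_self_eq_norm_sq]
  ring

/-- **(B3, backward) RADIAL BALANCE ALONG A BACKWARD ORBIT**: if `Y′(σ) = −W(Y(σ))` then
`d/dσ ⟪Y, W(Y)⟫ = −(|W(Y)|² + (2γ−1)⟪Y, W(Y)⟫ + γ(1−γ)|Y|² − ⟪Y, ∇P(Y)⟫)`. [folklore] -/
theorem hasDerivAt_inner_transport_backwardOrbit (h : IsSelfSimilarEulerProfile γ 0 U P) {Y : ℝ → EuclideanSpace ℝ (Fin 3)} {σ : ℝ}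
    (hY : HasDerivAt Y ((-1 : ℝ) • selfSimilarTransport γ 0 U (Y σ)) σ) :
    HasDerivAt (fun s => ⟪Y s, selfSimilarTransport γ 0 U (Y s)⟫)
      (-(‖selfSimilarTransport γ 0 U (Y σ)‖ ^ 2 + (2 * γ - 1) * ⟪Y σ, selfSimilarTransport γ 0 U (Y σ)⟫ +
        γ * (1 - γ) * ‖Y σ‖ ^ 2 - ⟪Y σ, gradient P (Y σ)⟫)) σ := by
  have hW : HasFDerivAt (selfSimilarTransport γ 0 U) (fderiv ℝ (selfSimilarTransport γ 0 U) (Y σ)) (Y σ) :=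
    (hasFDerivAt_selfSimilarTransport (γ := γ) (c := 0) h.differentiable_velocity (Y σ)).differentiableAt.hasFDerivAt
  have h1 := hY.inner ℝ (hW.comp_hasDerivAt σ hY)
  refine h1.congr_deriv ?_
  simp only [Function.comp_apply, map_smul, inner_smul_left, inner_smul_right, radialBalance h (Y σ), real_inner_self_eq_norm_sq,
    RCLike.conj_to_real]
  ring

/-- **(B3′) THE ORBIT VIRIAL IDENTITY**: along a forward orbit `Y′ = W(Y)`,
`d/dσ [e^{(1−2γ)σ} (ℋ(Y) + ½(1−2γ)⟪Y, W(Y)⟫)] = (1−2γ) e^{(1−2γ)σ} (P(Y) − ½⟪Y, ∇P(Y)⟫)` — the friction and the quadratic well drop out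
((3.31) `ℋ̇ = (2γ−1)|W|²` + (B3)). [cite: ConstantinIgnatovaVicol2026Putative, §3.4.3 eq. (3.31)] -/
theorem hasDerivAt_orbitVirial (h : IsSelfSimilarEulerProfile γ 0 U P) {Y : ℝ → EuclideanSpace ℝ (Fin 3)} {σ : ℝ}
    (hY : HasDerivAt Y (selfSimilarTransport γ 0 U (Y σ)) σ) :
    HasDerivAt (fun s => Real.exp ((1 - 2 * γ) * s) *
        (selfSimilarBernoulli γ 0 U P (Y s) + (1 / 2 : ℝ) * (1 - 2 * γ) * ⟪Y s, selfSimilarTransport γ 0 U (Y s)⟫))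
      ((1 - 2 * γ) * Real.exp ((1 - 2 * γ) * σ) * (P (Y σ) - (1 / 2 : ℝ) * ⟪Y σ, gradient P (Y σ)⟫)) σ := by
  have hHd : Differentiable ℝ (selfSimilarBernoulli γ 0 U P) := (h.contDiff_selfSimilarBernoulli).differentiable one_ne_zero
  have hH : HasDerivAt (fun s => selfSimilarBernoulli γ 0 U P (Y s))
      ((2 * γ - 1) * ‖selfSimilarTransport γ 0 U (Y σ)‖ ^ 2) σ := by
    have h1 := (hHd (Y σ)).hasFDerivAt.comp_hasDerivAt σ hY
    rw [h.fderiv_selfSimilarBernoulli_transport (Y σ)] at h1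
    exact h1
  have hI := hasDerivAt_inner_transport_orbit h hY
  have hF := hH.add (hI.const_mul ((1 / 2 : ℝ) * (1 - 2 * γ)))
  have hexp : HasDerivAt (fun s : ℝ => Real.exp ((1 - 2 * γ) * s)) ((1 - 2 * γ) * Real.exp ((1 - 2 * γ) * σ)) σ := by
    have h1 := ((hasDerivAt_id σ).const_mul (1 - 2 * γ)).exp
    simp only [id, mul_one] at h1
    convert h1 using 1; ring
  have hprod := hexp.mul hF
  refine hprod.congr_deriv ?_
  simp only [Pi.add_apply]
  -- the Bernoulli function at `Y σ`
  have hB : selfSimilarBernoulli γ 0 U P (Y σ) = (1 / 2 : ℝ) * ‖selfSimilarTransport γ 0 U (Y σ)‖ ^ 2 + P (Y σ) +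
      γ * (γ - 1) / 2 * ‖Y σ‖ ^ 2 := by
    rw [selfSimilarBernoulli_apply, selfSimilarTransport_apply, sub_zero]
  rw [hB]
  ring

/-- **(B4) THE PERIHELION LAW**: along a global forward orbit `Y′ = W(Y)`, a radial turning point `⟪Y(σ₀), W(Y(σ₀))⟫ = 0` at which the
radial pressure force is SUB-VIRIAL, `⟪Y, ∇P(Y)⟫ < |W(Y)|² + γ(1−γ)|Y|²`, is a local MINIMUM of `σ ↦ ½|Y(σ)|²`: such parcels fly by; an aphelion
(ejecta falling back) needs the gradient ridge `⟪Y, ∇P(Y)⟫ ≥ |W(Y)|² + γ(1−γ)|Y|²`. [folklore] -/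
theorem perihelionLaw (h : IsSelfSimilarEulerProfile γ 0 U P) {Y : ℝ → EuclideanSpace ℝ (Fin 3)}
    (hY : ∀ s, HasDerivAt Y (selfSimilarTransport γ 0 U (Y s)) s) {σ₀ : ℝ}
    (hturn : ⟪Y σ₀, selfSimilarTransport γ 0 U (Y σ₀)⟫ = 0)
    (hsub : ⟪Y σ₀, gradient P (Y σ₀)⟫ < ‖selfSimilarTransport γ 0 U (Y σ₀)‖ ^ 2 + γ * (1 - γ) * ‖Y σ₀‖ ^ 2) :
    IsLocalMin (fun s => (1 / 2 : ℝ) * ‖Y s‖ ^ 2) σ₀ := by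
  have hd1 : deriv (fun s => (1 / 2 : ℝ) * ‖Y s‖ ^ 2) = fun s => ⟪Y s, selfSimilarTransport γ 0 U (Y s)⟫ := by
    funext s; exact (hasDerivAt_half_norm_sq_orbit (hY s)).deriv
  have hd2 : deriv (deriv (fun s => (1 / 2 : ℝ) * ‖Y s‖ ^ 2)) σ₀ =
      ‖selfSimilarTransport γ 0 U (Y σ₀)‖ ^ 2 + (2 * γ - 1) * ⟪Y σ₀, selfSimilarTransport γ 0 U (Y σ₀)⟫ +
        γ * (1 - γ) * ‖Y σ₀‖ ^ 2 - ⟪Y σ₀, gradient P (Y σ₀)⟫ := by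
    rw [hd1]; exact (hasDerivAt_inner_transport_orbit h (hY σ₀)).deriv
  refine isLocalMin_of_deriv_deriv_pos ?_ ?_ ?_
  · rw [hd2, hturn, mul_zero, add_zero]; linarith
  · rw [hd1]; exact hturn
  · exact (hasDerivAt_half_norm_sq_orbit (hY σ₀)).continuousAt

end Ballistic

end Summit.NavierStokesRegularity.NavierStokesRegularity.Theorems.PowerGaugeEulerLiouville
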